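import Literature.Analysis.FluidPDE.LerayHopfBoundedContinuation
import Literature.Analysis.FluidPDE.LerayHopfProofs
import Literature.Analysis.FluidPDE.SereginSverakPressureProofs
import Literature.Analysis.FluidPDE.KNSSTypeIIContinuation
import Literature.Analysis.FluidPDE.CheskidovDaiOccupationCriterion
import HarnessLib

/-!
# A Leray–Hopf solution bounded on a time window is `H¹`-regular on that window

Analysis/FluidPDE **proofs file** (theorems only: no definitions, no named facts, no `sorry`).
Robinson–Rodrigo–Sadowski 2016, Thm. 8.17 (Serrin class `L²(0,T; L^∞)`, "blowup at time `T₁`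
is impossible") combined with Leray's structure theorem in the tree's `H¹` form
(`leray_continuation_H1_holds`, Cheskidov–Shvydkoy 2010, Thm. 2.4): a Leray–Hopf weak solution
of the unforced Navier–Stokes system on `ℝ³ × [0, T)` which is essentially bounded on
`(0, T) × ℝ³` is `H¹`-regular on `(0, T]` (`IsLerayHopfOn.isH1RegularOn_Ioc_of_ae_bound`), and —
by restarting at good times (`IsLerayHopfOn.exists_isLerayHopfOn_restart_Ioo`) — one which is
essentially bounded on a window `(t₁, T₂) × ℝ³`, `0 ≤ t₁`, `T₂ ≤ T`, is `H¹`-regular on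
`(t₁, T₂]` (`IsLerayHopfOn.isH1RegularOn_Ioc_of_ae_bound_window`). No datum regularity, no
decay and no smoothness is assumed. The first statement packages the argument the tree runs
inline for Lei–Zhang 2011 (`LeiZhang2011RegularityLerayHopf`); the window form is the one that
interior `L^∞` bounds (far-field ε-regularity plus continuity on compact sets) feed.

Appended (same topic — the regularity bridges for classical Leray–Hopf solutions):

* `IsClassicalNSSolutionOn.isH1RegularOn_Ioo_of_isLerayHopfOn` — **a classical solution of the
  unforced system on `ℝ³ × [0, T)` which is Leray–Hopf on `[0, T)` from `u(0)` is `H¹`-regular on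
  `(0, T)`**, with NO decay or boundedness hypothesis: on every window `(δ, T₂)`, `0 < δ < T₂ < T`,
  `u` is bounded — in the far field `|x| > R` by the tree's ε-regularity bound
  `SereginSverak2002.farField_bound` (Lemarié-Rieusset 2016, proof of Thm. 14.5 with Thm. 14.4,
  through the gauged normalised pressure), on the compact `[δ, T₂] × B̄(0, R)` by continuity — so
  the window form above applies;
* `IsClassicalNSSolutionOn.hasSmoothExtensionPast_of_isH1RegularOn_Ioc` — continuation THROUGH
  `t = T` of a classical Leray–Hopf solution which is `H¹`-regular on `(0, T]`
  (Robinson–Rodrigo–Sadowski 2016, proof of Thm. 12.3: Leray's local strong solution from a good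
  restart time, its classical representative in the Serrin class `L^∞_t L⁶_x`, weak–strong
  uniqueness, gluing; the argument of the Summits-side
  `CirculationFloor.Birth.extension_of_isH1RegularOn_Ioc`, re-homed here so that Literature
  files can use it);
* `IsMaximalSmoothSolution.isH1RegularOn_Ioo`, `IsMaximalSmoothSolution.not_isH1RegularOn_Ioc` —
  the lifespan of a maximal smooth finite-energy (Leray–Hopf) solution is an epoch of
  `H¹`-irregularity: `H¹`-regular on `(0, T)`, not on `(0, T]`;
* `cheskidov_dai_occupation_of_regular` — **the house form of Cheskidov–Dai's level-occupation
  criterion follows from its printed `H¹` form** (`CheskidovDaiOccupationCriterion.lean`): the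
  two bridges above are exactly the ones its docstring names (classical ⇒ `H¹`-regular on
  `(0, T)`; `H¹`-regular on `(0, T]` ⇒ smooth extension past `T`); the rapid decay of the datum
  is not used.

## Mathlib / tree search

Reused: `leray_continuation_H1_holds` (`CheskidovShvydkoyRegularProofs`),
`limsup_eH1NormSq_lt_top_of_ae_bound_near` (`LerayHopfBoundedContinuation`),
`IsLerayHopfOn.exists_isLerayHopfOn_restart_Ioo` (`CheskidovShvydkoyRegular`),
`IsLerayHopfOn.of_le` (`LerayHopfProofs`); Mathlib `ContinuousWithinAt.mono_of_mem_nhdsWithin`,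
`inter_mem_nhdsWithin`, `Ioi_mem_nhds`.

## References

* J. C. Robinson, J. L. Rodrigo, W. Sadowski, *The Three-Dimensional Navier–Stokes Equations*,
  CUP (2016), Thm. 8.17 with Lemma 8.16 (case `r = 2`, `s = ∞`); Thms. 6.10, 6.15 and the proof
  of Thm. 12.3 (p. 170). [RobinsonRodrigoSadowski2016]
* P. G. Lemarié-Rieusset, *The Navier–Stokes Problem in the 21st Century* (2016), proof of
  Thm. 14.5 (p. 512) with Thm. 14.4 (p. 505). [LemarieRieusset2016]
* A. Cheskidov, M. Dai, arXiv:1507.06611 = Proc. Edinburgh Math. Soc. (2025), §1 Thm. 1.1.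
  [CheskidovDai2015]
* A. Cheskidov, R. Shvydkoy, Arch. Ration. Mech. Anal. 195 (2010) = arXiv:0708.3067, Thm. 2.4.
  [CheskidovShvydkoy2010]
-/

noncomputable section

open MeasureTheory Set Function Filter Topology Metric
open scoped ENNReal NNReal

namespace Literature.Analysis.FluidPDE

variable {ν T : ℝ} {u₀ : EuclideanSpace ℝ (Fin 3) → EuclideanSpace ℝ (Fin 3)}
  {u : ℝ → EuclideanSpace ℝ (Fin 3) → EuclideanSpace ℝ (Fin 3)}

/-- **A Leray–Hopf solution essentially bounded on `(0, T) × ℝ³` is `H¹`-regular on `(0, T]`**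
(Robinson–Rodrigo–Sadowski 2016, Thm. 8.17 with `r = 2`, `s = ∞`, through Leray's structure
theorem `leray_continuation_H1_holds`: at the right end `β` of every interval of regularity the
bound on `(α, β) ⊆ (0, T)` gives `limsup_{t → β⁻} ‖u(t)‖²_{H¹} < ∞` by
`limsup_eH1NormSq_lt_top_of_ae_bound_near`). [cite: RobinsonRodrigoSadowski2016, Thm. 8.17 (r = 2, s = ∞) with Lemma 8.16] -/
theorem IsLerayHopfOn.isH1RegularOn_Ioc_of_ae_bound (hν : 0 < ν) (hT : 0 < T)
    (hLH : IsLerayHopfOn T ν 0 u₀ u) {M : ℝ}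
    (hbd : ∀ t ∈ Ioo 0 T, ∀ᵐ x ∂volume, ‖u t x‖ ≤ M) : IsH1RegularOn (Ioc 0 T) u :=
  leray_continuation_H1_holds ν T hν hT u₀ u hLH fun α β hα hαβ hβ hreg =>
    limsup_eH1NormSq_lt_top_of_ae_bound_near hν hLH hα hαβ hβ hreg (δ := β - α) (M := M)
      (sub_pos.2 hαβ) fun t ht => hbd t ⟨hα.trans_lt (by linarith [ht.1]), ht.2.trans_le hβ⟩

/-- **Window form**: a Leray–Hopf solution on `[0, T)` essentially bounded on `(t₁, T₂) × ℝ³`,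
`0 ≤ t₁`, `T₂ ≤ T`, is `H¹`-regular on `(t₁, T₂]` (void unless `t₁ < T₂`). Proof: for `t ∈ (t₁, T₂]` restart at a good
time `s ∈ (t₁, t)` (`exists_isLerayHopfOn_restart_Ioo`); the translate `u(· + s)` is Leray–Hopf
on `[0, T₂ - s)` and essentially bounded there, hence `H¹`-regular on `(0, T₂ - s]` by
`isH1RegularOn_Ioc_of_ae_bound`, i.e. `u` is `H¹`-regular on `(s, T₂] ∋ t`.
[cite: RobinsonRodrigoSadowski2016, Thm. 8.17 (r = 2, s = ∞) with Lemma 8.16] -/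
theorem IsLerayHopfOn.isH1RegularOn_Ioc_of_ae_bound_window (hν : 0 < ν)
    (hLH : IsLerayHopfOn T ν 0 u₀ u) {t₁ T₂ : ℝ} (ht₁ : 0 ≤ t₁) (hT₂ : T₂ ≤ T)
    {M : ℝ} (hbd : ∀ t ∈ Ioo t₁ T₂, ∀ᵐ x ∂volume, ‖u t x‖ ≤ M) :
    IsH1RegularOn (Ioc t₁ T₂) u := by
  -- regularity on `(s, T₂]` for good restart times `s`
  have key : ∀ t ∈ Ioc t₁ T₂, ∃ s ∈ Ioo t₁ t, IsH1RegularOn (Ioc s T₂) u := by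
    intro t ht
    obtain ⟨s, hs, hLHs⟩ :=
      hLH.exists_isLerayHopfOn_restart_Ioo hν.le ht₁ ht.1 (ht.2.trans hT₂)
    refine ⟨s, hs, ?_⟩
    have hsT₂ : 0 < T₂ - s := by linarith [hs.2, ht.2]
    have hLHw : IsLerayHopfOn (T₂ - s) ν 0 (u s) (fun τ => u (τ + s)) :=
      hLHs.of_le (by linarith)
    have hregw : IsH1RegularOn (Ioc 0 (T₂ - s)) (fun τ => u (τ + s)) :=
      hLHw.isH1RegularOn_Ioc_of_ae_bound hν hsT₂ (M := M) fun τ hτ =>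
        hbd (τ + s) ⟨by linarith [hτ.1, hs.1], by linarith [hτ.2]⟩
    -- translate back
    have hmaps : MapsTo (fun t' : ℝ => t' - s) (Ioc s T₂) (Ioc 0 (T₂ - s)) := fun t' ht' =>
      ⟨by linarith [ht'.1], by linarith [ht'.2]⟩
    refine ⟨fun t' ht' => ?_, ?_⟩
    · have h := hregw.1 (t' - s) (hmaps ht')
      simpa only [sub_add_cancel] using h
    · have h := hregw.2.comp (continuousOn_id.sub continuousOn_const) hmaps
      refine h.congr fun t' _ => ?_
      show eH1NormSq (u t') = eH1NormSq (u ((id t' - s) + s))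
      rw [id_eq, sub_add_cancel]
  refine ⟨fun t ht => ?_, fun t ht => ?_⟩
  · obtain ⟨s, hs, hreg⟩ := key t ht
    exact hreg.1 t ⟨hs.2, ht.2⟩
  · obtain ⟨s, hs, hreg⟩ := key t ht
    have hcw : ContinuousWithinAt (fun t => eH1NormSq (u t)) (Ioc s T₂) t := hreg.2 t ⟨hs.2, ht.2⟩
    refine hcw.mono_of_mem_nhdsWithin ?_
    have h1 : Ioc t₁ T₂ ∩ Ioi s ∈ 𝓝[Ioc t₁ T₂] t :=
      inter_mem_nhdsWithin _ (Ioi_mem_nhds hs.2)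
    exact Filter.mem_of_superset h1 fun t' ht' => ⟨ht'.2, ht'.1.2⟩

/-! ### Classical Leray–Hopf solutions -/

section Classical

variable {p : ℝ → EuclideanSpace ℝ (Fin 3) → ℝ}

/-- **A classical Leray–Hopf solution is `H¹`-regular below the final time.** Let `ν > 0`,
`T > 0`, `(u, p)` a classical solution of the unforced Navier–Stokes system on `ℝ³ × [0, T)` which
is Leray–Hopf on `[0, T)` from `u(0)`. Then `‖u(t)‖_{H¹}` is finite and continuous on `(0, T)`.
Proof: for `t ∈ (0, T)` put `δ = t/2`, `T₂ = (t + T)/2`; `u` is bounded on `(δ, T) × {|x| > R}`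
(`SereginSverak2002.farField_bound`: ε-regularity in the far field, Lemarié-Rieusset 2016 proof
of Thm. 14.5) and on `[δ, T₂] × B̄(0, R)` (continuity), hence `H¹`-regular on `(δ, T₂] ∋ t` by
`IsLerayHopfOn.isH1RegularOn_Ioc_of_ae_bound_window`. No decay of the datum is needed.
[cite: LemarieRieusset2016, proof of Thm. 14.5 (p. 512) with Thm. 14.4 (p. 505); RobinsonRodrigoSadowski2016, Thm. 8.17 (r = 2, s = ∞)] -/
theorem IsClassicalNSSolutionOn.isH1RegularOn_Ioo_of_isLerayHopfOn (hν : 0 < ν) (hT : 0 < T)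
    (hcl : IsClassicalNSSolutionOn (Ico 0 T) ν 0 u p) (hLH : IsLerayHopfOn T ν 0 (u 0) u) :
    IsH1RegularOn (Ioo 0 T) u := by
  -- regularity on `(δ, T₂]` around every `t ∈ (0, T)`
  have key : ∀ t ∈ Ioo 0 T, IsH1RegularOn (Ioc (t / 2) ((t + T) / 2)) u := by
    intro t ht
    have hδ : 0 < t / 2 := by linarith [ht.1]
    have hT₂ : (t + T) / 2 < T := by linarith [ht.2]
    -- far field
    obtain ⟨R, M₁, hfar⟩ := SereginSverak2002.farField_bound hν hT hcl hLH hδ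
    -- near field: continuity on the compact `[δ, T₂] × B̄(0, R)`
    set K : Set (ℝ × EuclideanSpace ℝ (Fin 3)) :=
      Icc (t / 2) ((t + T) / 2) ×ˢ closedBall (0 : EuclideanSpace ℝ (Fin 3)) R with hK
    have hKc : IsCompact K := isCompact_Icc.prod (isCompact_closedBall _ _)
    have hKsub : K ⊆ Ico 0 T ×ˢ (univ : Set (EuclideanSpace ℝ (Fin 3))) := by
      rintro ⟨s, x⟩ ⟨⟨hs1, hs2⟩, -⟩
      exact ⟨⟨hδ.le.trans hs1, hs2.trans_lt hT₂⟩, mem_univ _⟩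
    obtain ⟨M₂, hM₂⟩ := hKc.exists_bound_of_continuousOn
      ((SereginSverak2002.continuousOn_uncurry hcl).mono hKsub)
    -- the bound on the window `(δ, T₂)`
    have hbd : ∀ s ∈ Ioo (t / 2) ((t + T) / 2), ∀ᵐ x ∂volume, ‖u s x‖ ≤ max M₁ M₂ := by
      intro s hs
      refine ae_of_all _ fun x => ?_
      rcases lt_or_ge R ‖x‖ with hx | hx
      · exact (hfar s ⟨hs.1, hs.2.trans hT₂⟩ x hx).trans (le_max_left _ _)
      · have hmem : ((s, x) : ℝ × EuclideanSpace ℝ (Fin 3)) ∈ K :=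
          ⟨⟨hs.1.le, hs.2.le⟩, mem_closedBall_zero_iff.2 hx⟩
        exact (hM₂ (s, x) hmem).trans (le_max_right _ _)
    exact hLH.isH1RegularOn_Ioc_of_ae_bound_window hν hδ.le hT₂.le hbd
  refine ⟨fun t ht => (key t ht).1 t ⟨by linarith [ht.1], by linarith [ht.2]⟩, fun t ht => ?_⟩
  have hreg := key t ht
  have htI : t ∈ Ioc (t / 2) ((t + T) / 2) := ⟨by linarith [ht.1], by linarith [ht.2]⟩
  have hcw : ContinuousWithinAt (fun t => eH1NormSq (u t)) (Ioc (t / 2) ((t + T) / 2)) t :=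
    hreg.2 t htI
  refine hcw.mono_of_mem_nhdsWithin (mem_nhdsWithin_of_mem_nhds ?_)
  exact mem_of_superset (Ioo_mem_nhds htI.1 (by linarith [ht.2])) Ioo_subset_Ioc_self

/-- **Continuation through `t = T` of an `H¹`-regular classical Leray–Hopf solution**
(Robinson–Rodrigo–Sadowski 2016, proof of Thm. 12.3, p. 170, with Thm. 6.15 =
`leray_local_strong_H1_of_regular leray_local_regular_H1_holds`, Thm. 8.17 (first clause) =
`ladyzhenskaya_prodi_serrin_holds` and Thm. 6.10 = `serrin_weak_strong_uniqueness_holds`): a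
classical solution `(u, p)` of the unforced system on `ℝ³ × [0, T)`, Leray–Hopf on `[0, T)` from
`u 0` and `H¹`-regular on `(0, T]`, extends as a classical solution past `T`. A uniform bound
`‖u(t)‖²_{H¹} ≤ A` on `[T/2, T]`, Leray's local strong solution with lifespan
`τ = c ν³/(A² + 1)` from a good restart time `s ∈ (max (T/2) (T - τ/2), T)`, its classical
representative in the Serrin class `L^∞_t L⁶_x`, weak–strong uniqueness upgraded to everywhere
equality of the continuous slices, and gluing along `(s, T)` (`IsClassicalNSSolutionOn.glue`).
(The argument of the Summits-side `CirculationFloor.Birth.extension_of_isH1RegularOn_Ioc`.)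
[cite: RobinsonRodrigoSadowski2016, proof of Thm 12.3 (PDF p. 170) with Thms 6.15, 8.17, 6.10] -/
theorem IsClassicalNSSolutionOn.hasSmoothExtensionPast_of_isH1RegularOn_Ioc (hν : 0 < ν)
    (hT : 0 < T) (hcl : IsClassicalNSSolutionOn (Ico 0 T) ν 0 u p)
    (hLH : IsLerayHopfOn T ν 0 (u 0) u) (hregT : IsH1RegularOn (Ioc 0 T) u) :
    HasSmoothExtensionPast ν 0 u T := by
  have h₁ : leray_local_strong_H1 := leray_local_strong_H1_of_regular leray_local_regular_H1_holds
  have hLPS : ladyzhenskaya_prodi_serrin := ladyzhenskaya_prodi_serrin_holds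
  -- `‖u(t)‖²_{H¹} ≤ A < ∞` on `[T/2, T]`
  have hreg : IsH1RegularOn (Icc (T / 2) T) u :=
    hregT.mono fun t ht => ⟨by linarith [ht.1], ht.2⟩
  obtain ⟨A, hAtop, hA⟩ := hreg.exists_forall_le isCompact_Icc subset_rfl
  -- Leray's lifespan for data of squared `H¹` norm `≤ a = A.toReal`
  obtain ⟨c, hc, hlocc⟩ := h₁
  set a : ℝ := A.toReal with ha
  have ha0 : 0 ≤ a := ENNReal.toReal_nonneg
  set τ : ℝ := c * ν ^ 3 / (a ^ 2 + 1) with hτ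
  have hcν : 0 < c * ν ^ 3 := mul_pos hc (pow_pos hν 3)
  have hτpos : 0 < τ := div_pos hcν (by positivity)
  have hτc : a ^ 2 * τ ≤ c * ν ^ 3 := by
    have h1 : a ^ 2 * τ = c * ν ^ 3 * (a ^ 2 / (a ^ 2 + 1)) := by
      rw [hτ]
      ring
    rw [h1]
    exact mul_le_of_le_one_right hcν.le (div_le_one_of_le₀ (by linarith) (by positivity))
  -- a good restart time `s ∈ (max (T/2) (T - τ/2), T)`
  set s₀ : ℝ := max (T / 2) (T - τ / 2) with hs₀
  have hs₀0 : 0 ≤ s₀ := le_max_of_le_left (by linarith)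
  have hs₀T : s₀ < T := max_lt (by linarith) (by linarith)
  obtain ⟨s, hs, hLHs⟩ := hLH.exists_isLerayHopfOn_restart_Ioo hν.le hs₀0 hs₀T le_rfl
  have hsT2 : T / 2 ≤ s := (le_max_left _ _).trans hs.1.le
  have hsτ : T < s + τ := by
    have h1 : T - τ / 2 < s := (le_max_right _ _).trans_lt hs.1
    linarith
  have hs0 : 0 < s := by linarith
  have hTs : 0 < T - s := sub_pos.2 hs.2
  have hTsτ : T - s ≤ τ := by linarith
  -- the datum `u s ∈ H¹` with `‖∇u(s)‖² ≤ a`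
  have hu2 : MemLp (u s) 2 volume := hLH.memLp s ⟨hs0.le, hs.2.le⟩
  have hdiv : IsWeaklyDivFree (u s) := hLHs.isWeaklyDivFree_datum hTs
  have hgrad : eWeakGradL2Sq (u s) ≤ ENNReal.ofReal a := by
    calc eWeakGradL2Sq (u s) ≤ eH1NormSq (u s) := le_add_self
      _ ≤ A := hA s ⟨hsT2, hs.2.le⟩
      _ = ENNReal.ofReal a := (ENNReal.ofReal_toReal hAtop.ne).symm
  -- Leray's local strong solution `v` from `u s` on `[0, τ]` (RRS Thm. 6.15)
  obtain ⟨v, hv, hv0, hvreg⟩ := hlocc hν hτpos hu2 hdiv ha0 hgrad hτc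
  -- its classical representative `(V, P)` on `(0, τ]` (RRS Thm. 8.17, first clause, `L^∞_t L⁶_x`)
  have hvS : MemLqLp ∞ 6 v (Ioo 0 τ) :=
    memLqLp_top_six_of_isH1RegularOn_Icc hvreg fun t ht => hv.memLp t ht
  have hr6 : (3 : ℝ≥0∞) < 6 := by norm_num
  obtain ⟨V, P, hVP, hvV⟩ := hLPS hν hτpos hv hr6 serrin_exponents_top_six hvS
  -- weak–strong uniqueness on `[0, T - s)`: `u (t + s) = v t` a.e., `0 < t ≤ T - s`
  have hae : ∀ t ∈ Ioc 0 (T - s), (fun t => u (t + s)) t =ᵐ[volume] v t :=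
    serrin_weak_strong_uniqueness_holds hν hTs (hv.of_le hTsτ) hu2 (q := ∞) (r := 6) hr6
      serrin_exponents_top_six (hvS.mono_set (Ioo_subset_Ioo_right hTsτ)) hLHs
  -- everywhere agreement of the continuous slices on `(s, T)`
  have heq : ∀ t ∈ Ioo s T, u t = V (t + -s) := by
    intro t ht
    have hts : t - s ∈ Ioc 0 (T - s) := ⟨sub_pos.2 ht.1, by linarith [ht.2]⟩
    have h1 : u t =ᵐ[volume] v (t - s) := by
      have h := hae (t - s) hts
      simpa only [sub_add_cancel] using h
    have h2 : v (t - s) =ᵐ[volume] V (t - s) := hvV (t - s) ⟨hts.1, hts.2.trans hTsτ⟩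
    have hcu : Continuous (u t) :=
      (hcl.contDiff_velocity ⟨hs0.le.trans ht.1.le, ht.2⟩).continuous
    have hcV : Continuous (V (t - s)) :=
      (hVP.contDiff_velocity ⟨hts.1, hts.2.trans hTsτ⟩).continuous
    rw [← sub_eq_add_neg]
    exact (Continuous.ae_eq_iff_eq volume hcu hcV).1 (h1.trans h2)
  -- the continuation piece `(V, P)(· - s)` on `(s, s + τ)`
  have h₂ : IsClassicalNSSolutionOn (Ioo s (s + τ)) ν 0 (fun t => V (t + -s))
      (fun t => P (t + -s)) := by
    have hVP' := hVP.comp_add_right (-s)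
    have h0 : (fun t => (0 : ℝ → EuclideanSpace ℝ (Fin 3) → EuclideanSpace ℝ (Fin 3)) (t + -s)) =
        0 := rfl
    rw [h0] at hVP'
    exact hVP'.mono (fun t ht => ⟨by simp only [mem_Ioo] at ht ⊢; linarith [ht.1],
      by simp only [mem_Ioo] at ht ⊢; linarith [ht.2]⟩) isOpen_Ioo.uniqueDiffOn
  -- glue along the overlap `(s, T)`
  exact ⟨s + τ, hsτ, _, _, hcl.glue h₂ hs0.le hs.2 hsτ.le heq, fun t ht => by
    simp only [if_pos ht.2]⟩

/-- **A maximal smooth Leray–Hopf solution is `H¹`-regular below its lifespan**: if `(u, p)` is a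
maximal smooth solution with finite lifespan `T > 0` of the unforced system (`ν > 0`) which is
Leray–Hopf from `u 0`, then `‖u(t)‖_{H¹}` is finite and continuous on `(0, T)`
(`isH1RegularOn_Ioo_of_isLerayHopfOn` for the classical solution `hmax.1`). [cite: LemarieRieusset2016, proof of Thm. 14.5 (p. 512) with Thm. 14.4 (p. 505); RobinsonRodrigoSadowski2016, Thm. 8.17 (r = 2, s = ∞)] -/
theorem IsMaximalSmoothSolution.isH1RegularOn_Ioo (hν : 0 < ν) (hT : 0 < T)
    (hmax : IsMaximalSmoothSolution ν 0 u p T) (hLH : IsLerayHopfOn T ν 0 (u 0) u) :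
    IsH1RegularOn (Ioo 0 T) u :=
  hmax.1.isH1RegularOn_Ioo_of_isLerayHopfOn hν hT hLH

/-- **At the lifespan of a maximal smooth Leray–Hopf solution the `H¹` norm is NOT regular**:
`u` is not `H¹`-regular on `(0, T]` — otherwise it would extend as a classical solution past `T`
(`hasSmoothExtensionPast_of_isH1RegularOn_Ioc`), against maximality. Together with
`IsMaximalSmoothSolution.isH1RegularOn_Ioo`: the lifespan of a maximal smooth finite-energy
solution is an epoch of `H¹`-irregularity in the sense of Leray's structure theorem, so every
statement of the tree about Leray–Hopf solutions "`H¹`-regular on `(0, T)` but not on `(0, T]`"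
applies to it. [cite: RobinsonRodrigoSadowski2016, proof of Thm 12.3 (PDF p. 170) with Thms 6.15, 8.17, 6.10] -/
theorem IsMaximalSmoothSolution.not_isH1RegularOn_Ioc (hν : 0 < ν) (hT : 0 < T)
    (hmax : IsMaximalSmoothSolution ν 0 u p T) (hLH : IsLerayHopfOn T ν 0 (u 0) u) :
    ¬ IsH1RegularOn (Ioc 0 T) u := fun h =>
  hmax.2 (hmax.1.hasSmoothExtensionPast_of_isH1RegularOn_Ioc hν hT hLH h)

end Classical

/-! ### Cheskidov–Dai's criterion: the house form from the printed form -/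

/-- **The house form of Cheskidov–Dai's level-occupation criterion follows from its printed
`H¹` form** (`cheskidov_dai_occupation_regular → cheskidov_dai_occupation`, both in
`CheskidovDaiOccupationCriterion.lean`; same absolute constant `c`): a classical solution on
`ℝ³ × [0, T)` which is Leray–Hopf from `u 0` is `H¹`-regular on `(0, T)`
(`IsClassicalNSSolutionOn.isH1RegularOn_Ioo_of_isLerayHopfOn`), so the printed criterion makes
it `H¹`-regular on `(0, T]`, and then it extends as a classical solution past `T`
(`IsClassicalNSSolutionOn.hasSmoothExtensionPast_of_isH1RegularOn_Ioc`). The rapid decay of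
`u 0` in the house form is not used. [cite: CheskidovDai2015, §1 Thm. 1.1 (case b ≡ 0, r = ∞)] -/
theorem cheskidov_dai_occupation_of_regular (h : cheskidov_dai_occupation_regular) :
    cheskidov_dai_occupation := by
  obtain ⟨c, hc, hreg⟩ := h
  refine ⟨c, hc, fun ν T hν hT u p hcl hLH _ hocc => ?_⟩
  exact hcl.hasSmoothExtensionPast_of_isH1RegularOn_Ioc hν hT hLH
    (hreg ν T hν hT (u 0) u hLH (hcl.isH1RegularOn_Ioo_of_isLerayHopfOn hν hT hLH) hocc)

end Literature.Analysis.FluidPDE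

end
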